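import Summits.AtomisticToContinuum.BoseEinsteinCondensation.Theses.BECSyncSkeleton
import Literature.MathematicalPhysics.QuantumLattice.QuantumRotorGroundStateLROProofs

/-!
# Typed split of crux `InhomogeneousRotorLRO` (stmt-AtomisticToContinuum-12371, route BECSyncSkeleton)

Crux-strategist decomposition (BC2 redirect, 2026-08-17): the engine crux
`InhomogeneousRotorLRO` — ground-state long-range order of ferromagnetic quantum rotor arrays that
contain the torus `(ℤ/K)³` inside an arbitrary decoration, in the every-near-minimiser form — is the
conjunction of two pieces of different kind, joined through the homogeneous anchor that is ALREADY
A THEOREM in the tree (`QuantumRotor.sum_torusCorrelation_ge`, Kennedy–Lieb–Shastry on the even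
torus at fixed side, + `klsRiemannSum_eventually_le`):

* `NearMinimiserRigidity` (piece X₁, spectral): for every finite array, every `ε > 0` has a `δ > 0`
  such that EVERY `δ`-near-minimiser reproduces each pair correlation of the variational (inf-sup)
  ground-state rendering up to `−ε` (compact resolvent on `T^n` + uniqueness of the positive ground
  state: near-minimisers converge);
* `GinibreDomination` (piece X₂, correlation inequality): the inf-sup ground-state correlation of the
  decorated array at two torus sites dominates the homogeneous `torusCorrelation 3 K h₀ J₀`
  (T = 0 Griffiths–Ginibre monotonicity in the couplings, Feynman–Kac/Trotter path space).

This file proves the assembly `X₁ → X₂ → InhomogeneousRotorLRO` with `α_c = 16`, the pieces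
written out as the literal statements of the route's child items (filed by
`route edit --split InhomogeneousRotorLRO`); it supports, and does not close, stmt-12371.
-/

namespace Summit.AtomisticToContinuum.BoseEinsteinCondensation.Theorems

open scoped BigOperators
open Filter Literature.MathematicalPhysics.QuantumLattice Literature.Probability.LatticeModels
open Summit.AtomisticToContinuum.BoseEinsteinCondensation.Theses.BECSyncSkeleton

/-- **Homogeneous anchor at fixed side.** From the in-tree finite-volume KLS bound
`QuantumRotor.sum_torusCorrelation_ge` and `klsRiemannSum_eventually_le` (`R_L ≤ 0.69` eventually):
there are a universal `c > 0` and `K₀` such that on every even torus `(ℤ/K)³`, `K ≥ K₀`, the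
variational ground-state correlations of the homogeneous rotators with `J₀/h₀ > 16` satisfy
`c·K⁶ ≤ Σ_{x,y} ⟨cos(φ_x − φ_y)⟩`. (The constant is the one of
`QuantumRotor.KleinPerez1992_rotorGroundStateLRO_holds`, read at fixed `K` instead of in the
`liminf`.) [cite: KLS1988PRL, eq. (8)] [cite: WojtkiewiczPuszStachura2016, Thm. 3.3] -/
theorem becSyncSkeleton_homogeneousAnchor_fixedK :
    ∃ c : ℝ, 0 < c ∧ ∃ K₀ : ℕ, ∀ (K : ℕ) [NeZero K], Even K → K₀ ≤ K →
      ∀ h₀ J₀ : ℝ, 0 < h₀ → 0 < J₀ → 16 < J₀ / h₀ →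
        c * (K : ℝ) ^ 6 ≤ ∑ x : TorusSite 3 K, ∑ y : TorusSite 3 K,
          QuantumRotor.torusCorrelation 3 K h₀ J₀ x y := by
  obtain ⟨ρ, hρ, hρev⟩ := klsRiemannSum_eventually_le 3 (by norm_num)
  have hsqrt2 : Real.sqrt 2 < 1.42 := by
    rw [Real.sqrt_lt' (by norm_num)]
    norm_num
  have hρ' : ρ < 0.71 := by linarith
  set c : ℝ := 1 - 2 * (1 / 11) * (2 * max ρ 0 + 2) with hc_def
  have hρ0 : 0 ≤ max ρ 0 := le_max_right _ _
  have hρ0' : max ρ 0 < 0.71 := max_lt hρ' (by norm_num)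
  have hc : 0 < c := by rw [hc_def]; nlinarith
  obtain ⟨N₀, hN₀⟩ := eventually_atTop.1 hρev
  refine ⟨c, hc, max 4 N₀, fun K _ hKe hK h₀ J₀ hh₀ hJ₀ hα => ?_⟩
  have h4 : 4 ≤ K := le_trans (le_max_left _ _) hK
  have hN : N₀ ≤ K := le_trans (le_max_right _ _) hK
  have hR : klsRiemannSum 3 K ≤ max ρ 0 := (hN₀ K hN).trans (le_max_left _ _)
  have hx : h₀ / (8 * J₀) ≤ 1 / 128 := by
    rw [div_le_div_iff₀ (by positivity) (by norm_num)]
    have : 16 * h₀ < J₀ := by rwa [lt_div_iff₀ hh₀] at hα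
    linarith
  have hs : Real.sqrt (h₀ / (8 * J₀)) ≤ 1 / 11 := by
    calc Real.sqrt (h₀ / (8 * J₀)) ≤ Real.sqrt (1 / 128) := Real.sqrt_le_sqrt hx
      _ ≤ 1 / 11 := by
          rw [Real.sqrt_le_left (by norm_num)]
          norm_num
  have hsum := QuantumRotor.sum_torusCorrelation_ge (d := 3) (L := K) (by norm_num) hKe h4 hh₀ hJ₀
  have hR0 : 0 ≤ klsRiemannSum 3 K := klsRiemannSum_nonneg _ _
  have hs0 : 0 ≤ Real.sqrt (h₀ / (8 * J₀)) := Real.sqrt_nonneg _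
  have hconst : c ≤ 1 - 2 * Real.sqrt (h₀ / (8 * J₀)) * (2 * klsRiemannSum 3 K + 2) := by
    rw [hc_def]
    nlinarith [mul_le_mul hs (show 2 * klsRiemannSum 3 K + 2 ≤ 2 * max ρ 0 + 2 by linarith)
      (by linarith) (by norm_num)]
  have hK6 : ((K : ℝ) ^ 3) ^ 2 = (K : ℝ) ^ 6 := by ring
  have hpos : (0 : ℝ) ≤ (K : ℝ) ^ 6 := by positivity
  calc c * (K : ℝ) ^ 6
      ≤ (1 - 2 * Real.sqrt (h₀ / (8 * J₀)) * (2 * klsRiemannSum 3 K + 2)) * (K : ℝ) ^ 6 :=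
        mul_le_mul_of_nonneg_right hconst hpos
    _ = (1 - 2 * Real.sqrt (h₀ / (8 * J₀)) * (2 * klsRiemannSum 3 K + 2)) * ((K : ℝ) ^ 3) ^ 2 := by
        rw [hK6]
    _ ≤ _ := hsum

/-- **Assembly of the split** `NearMinimiserRigidity → GinibreDomination → InhomogeneousRotorLRO`
(the two hypotheses are, verbatim, the statements of the child items `NearMinimiserRigidity` and
`GinibreDomination` of route BECSyncSkeleton). Proof: take `α_c = 16` and the anchor constant `c`;
for `g > 16`, `c₀ := c/2`; rigidity with `ε := c/2` gives `δ`; for a `δ`-near-minimiser `Ψ` and torus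
sites `x, y`, `⟨cos(φ_{ex} − φ_{ey})⟩_Ψ ≥ G(ex, ey) − c/2 ≥ torusCorrelation x y − c/2` (rigidity, then
domination); summing over the `K⁶` pairs and inserting the anchor `Σ torusCorrelation ≥ c K⁶` gives
`Σ ⟨cos⟩_Ψ ≥ (c/2) K⁶`. [folklore] -/
theorem InhomogeneousRotorLRO_of_subs :
    (∀ (n : ℕ) (h : Fin n → ℝ) (J : Fin n → Fin n → ℝ), (∀ a, 0 < h a) → (∀ a b, J a b = J b a) →
    (∀ a b, 0 ≤ J a b) →
    let E : QuantumRotor.TrialState (Fin n) → ENNReal := fun Ψ =>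
      ∫⁻ φ in QuantumRotor.angleCell (Fin n),
        (∑ a, ENNReal.ofReal (h a / 2) * (‖fderiv ℝ Ψ.ψ φ (Pi.single a 1)‖₊ : ENNReal) ^ 2) +
          ENNReal.ofReal ((1 / 2) * ∑ a, ∑ b, J a b * (1 - Real.cos (φ a - φ b))) *
            (‖Ψ.ψ φ‖₊ : ENNReal) ^ 2;
    ∀ ε : ℝ, 0 < ε → ∃ δ : ℝ, 0 < δ ∧ ∀ Ψ : QuantumRotor.TrialState (Fin n),
      E Ψ ≤ (⨅ Φ : QuantumRotor.TrialState (Fin n), E Φ) + ENNReal.ofReal δ →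
        ∀ a b : Fin n,
          (⨅ δ' : {δ' : ℝ // 0 < δ'},
              ⨆ Φ : {Φ : QuantumRotor.TrialState (Fin n) //
                  E Φ ≤ (⨅ Φ' : QuantumRotor.TrialState (Fin n), E Φ') + ENNReal.ofReal δ'.1},
                QuantumRotor.cosCorrelation Φ.1 a b) - ε ≤
            QuantumRotor.cosCorrelation Ψ a b) →
    (∀ (K : ℕ) [NeZero K] (n : ℕ) (e : TorusSite 3 K → Fin n), Function.Injective e →
    ∀ (h : Fin n → ℝ) (J : Fin n → Fin n → ℝ) (h₀ J₀ : ℝ), 0 < h₀ → 0 < J₀ → (∀ a, 0 < h a) →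
      (∀ a b, J a b = J b a) → (∀ a b, 0 ≤ J a b) → (∀ x, h (e x) = h₀) →
      (∀ (x : TorusSite 3 K) (i : Fin 3), J₀ ≤ J (e x) (e (x + Pi.single i 1))) →
      let E : QuantumRotor.TrialState (Fin n) → ENNReal := fun Ψ =>
        ∫⁻ φ in QuantumRotor.angleCell (Fin n),
          (∑ a, ENNReal.ofReal (h a / 2) * (‖fderiv ℝ Ψ.ψ φ (Pi.single a 1)‖₊ : ENNReal) ^ 2) +
            ENNReal.ofReal ((1 / 2) * ∑ a, ∑ b, J a b * (1 - Real.cos (φ a - φ b))) *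
              (‖Ψ.ψ φ‖₊ : ENNReal) ^ 2;
      ∀ x y : TorusSite 3 K,
        QuantumRotor.torusCorrelation 3 K h₀ J₀ x y ≤
          ⨅ δ' : {δ' : ℝ // 0 < δ'},
            ⨆ Φ : {Φ : QuantumRotor.TrialState (Fin n) //
                E Φ ≤ (⨅ Φ' : QuantumRotor.TrialState (Fin n), E Φ') + ENNReal.ofReal δ'.1},
              QuantumRotor.cosCorrelation Φ.1 (e x) (e y)) →
      InhomogeneousRotorLRO := by
  intro hX₁ hX₂
  obtain ⟨c, hc, K₀, hK₀⟩ := becSyncSkeleton_homogeneousAnchor_fixedK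
  refine ⟨16, by norm_num, fun g hg => ⟨c / 2, by positivity, K₀, ?_⟩⟩
  intro K _ hKe hK n e he h J h₀ J₀ hh₀ hJ₀ hg' hh hJs hJ0 hhe hJe
  -- the anchor
  have hα : 16 < J₀ / h₀ := lt_of_lt_of_le hg hg'
  have hanchor := hK₀ K hKe hK h₀ J₀ hh₀ hJ₀ hα
  -- rigidity with ε := c/2
  have h1 := hX₁ n h J hh hJs hJ0
  obtain ⟨δ, hδ, hδΨ⟩ := h1 (c / 2) (by positivity)
  -- domination
  have h2 := hX₂ K n e he h J h₀ J₀ hh₀ hJ₀ hh hJs hJ0 hhe hJe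
  refine ⟨δ, hδ, fun Ψ hΨ => ?_⟩
  have hpt : ∀ x y : TorusSite 3 K,
      QuantumRotor.torusCorrelation 3 K h₀ J₀ x y - c / 2 ≤
        QuantumRotor.cosCorrelation Ψ (e x) (e y) := by
    intro x y
    have hA := hδΨ Ψ hΨ (e x) (e y)
    have hB := h2 x y
    linarith
  have hcard : (Fintype.card (TorusSite 3 K) : ℝ) = (K : ℝ) ^ 3 := by
    have hc3 : Fintype.card (TorusSite 3 K) = K ^ 3 := by simp [Fintype.card_pi, ZMod.card]
    rw [hc3]; push_cast; ring
  have hsum : ∑ x : TorusSite 3 K, ∑ y : TorusSite 3 K,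
      (QuantumRotor.torusCorrelation 3 K h₀ J₀ x y - c / 2) ≤
        ∑ x : TorusSite 3 K, ∑ y : TorusSite 3 K, QuantumRotor.cosCorrelation Ψ (e x) (e y) :=
    Finset.sum_le_sum fun x _ => Finset.sum_le_sum fun y _ => hpt x y
  have hsplit : ∑ x : TorusSite 3 K, ∑ y : TorusSite 3 K,
      (QuantumRotor.torusCorrelation 3 K h₀ J₀ x y - c / 2) =
        (∑ x : TorusSite 3 K, ∑ y : TorusSite 3 K, QuantumRotor.torusCorrelation 3 K h₀ J₀ x y) -
          (K : ℝ) ^ 3 * ((K : ℝ) ^ 3 * (c / 2)) := by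
    simp only [Finset.sum_sub_distrib, Finset.sum_const, Finset.card_univ, nsmul_eq_mul, hcard]
  rw [hsplit] at hsum
  have hK6 : (K : ℝ) ^ 3 * ((K : ℝ) ^ 3 * (c / 2)) = (c / 2) * (K : ℝ) ^ 6 := by ring
  rw [hK6] at hsum
  linarith


end Summit.AtomisticToContinuum.BoseEinsteinCondensation.Theorems
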